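import Mathlib
import Literature.MathematicalPhysics.QuantumFieldTheory.StrongCouplingInfiniteVolume

/-!
# LatticeQCDFlow / Scaling — Taylor jets of tilted integrals and the covariance jet from moments
# (the analytic layer of the leading-coefficient identity (LC), item 120's successor target)

HONEST FRAMING: exact (Metropolis-corrected) sampling algorithms for lattice gauge theory;
figures of merit are autocorrelation/cost numbers at stated couplings and volumes; no
continuum-physics claim.

Venture `LatticeQCDFlow` (cell pub-lqcd), topic `Scaling`, FANOUT row 30 (lean-1) — OUR WORK, the
measure-free half of the leading-coefficient identity (LC) of HOME/lean/theory2/LANDING.md §32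
(THEORY-2.md §3.1 (hw)): the truncated plaquette–plaquette correlation of the strong-coupling
expansion is a ratio of TILTED INTEGRALS `β ↦ ∫ F e^{β C} dν` over a probability space, and its
Taylor jet at `β = 0` is decided by finitely many MOMENTS `∫ F Cⁱ dν`.

* `tilt ν C F β = ∫ F e^{βC} dν`, `cmoment ν C F i = ∫ F Cⁱ dν`, `tiltPoly ν C F k` (the Taylor
  polynomial of order `< k`); `norm_tilt_sub_tiltPoly_le` — for `|C| ≤ M`, `‖F‖ ≤ K` and
  `‖β‖ M ≤ 1`: `‖tilt β − tiltPoly k β‖ ≤ K (‖β‖M)ᵏ (k+1)/(k!·k)` (Mathlib's `Complex.exp_bound`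
  integrated); `tilt_jetEq` — `JetEq k (tilt ν C F) (tiltPoly ν C F k)` in the jet vocabulary of
  the tree's strong-coupling files (`StrongCouplingInfiniteVolume.JetEq`);
* `tendsto_tilt_one`, `eventually_tilt_one_ne_zero`, `bddAt_inv_tilt_one` — the normalising
  integral `∫ e^{βC} dν → 1`, so ratios are jets of ratios;
* `eventually_ne_zero_and_bddAt_inv_of_continuous`, `bddAt_of_continuous` — the same for the
  Taylor polynomials.
The covariance jet lemma (the `β⁴/32` of two parallel `U(1)` plaquettes one unit apart
[cite: MontvayMunster1994, §3.6.2 (3.437)]) is the sequel `Scaling/TiltedCovarianceJet.lean`.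
Elementary (Taylor's theorem with Mathlib's remainder bound, integrated); nothing is cited as a
fact; three `def`s (`tilt`, `cmoment`, `tiltPoly`), no `sorry`.
-/

noncomputable section

open MeasureTheory Filter Topology Asymptotics Finset
open Literature.MathematicalPhysics.QuantumFieldTheory (JetEq BddAt)

namespace Summit.Ventures.LatticeQCDFlow.Theory2.Tilted

variable {Ω : Type*} [MeasurableSpace Ω]

/-! ## §1. Tilted integrals and their Taylor polynomials -/

/-- The tilted integral `β ↦ ∫ F e^{β C} dν` (complex coupling `β`). [folklore] -/
def tilt (ν : Measure Ω) (C : Ω → ℝ) (F : Ω → ℂ) (β : ℂ) : ℂ :=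
  ∫ ω, F ω * Complex.exp (β * (C ω : ℂ)) ∂ν

/-- The moments `∫ F Cⁱ dν`. [folklore] -/
def cmoment (ν : Measure Ω) (C : Ω → ℝ) (F : Ω → ℂ) (i : ℕ) : ℂ :=
  ∫ ω, F ω * (C ω : ℂ) ^ i ∂ν

/-- The Taylor polynomial of order `< k` of the tilted integral: `∑_{i<k} βⁱ/i! · ∫ F Cⁱ dν`. [folklore] -/
def tiltPoly (ν : Measure Ω) (C : Ω → ℝ) (F : Ω → ℂ) (k : ℕ) (β : ℂ) : ℂ :=
  ∑ i ∈ range k, β ^ i / (i.factorial : ℂ) * cmoment ν C F i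

/-- Pointwise Taylor bound: `‖F eˣ − ∑_{i<k} xⁱ/i! F‖ ≤ K ‖x‖ᵏ (k+1)/(k!k)` for `‖x‖ ≤ 1`. [folklore] -/
theorem norm_mul_exp_sub_sum_le {F x : ℂ} {K : ℝ} (hF : ‖F‖ ≤ K) (hx : ‖x‖ ≤ 1) {k : ℕ}
    (hk : 0 < k) :
    ‖F * Complex.exp x - ∑ i ∈ range k, x ^ i / (i.factorial : ℂ) * F‖ ≤
      K * (‖x‖ ^ k * ((k.succ : ℝ) * ((k.factorial : ℝ) * k)⁻¹)) := by
  have h : F * Complex.exp x - ∑ i ∈ range k, x ^ i / (i.factorial : ℂ) * F =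
      F * (Complex.exp x - ∑ i ∈ range k, x ^ i / (i.factorial : ℂ)) := by
    rw [mul_sub, Finset.mul_sum]
    congr 1
    exact Finset.sum_congr rfl fun i _ => by ring
  rw [h, norm_mul]
  exact mul_le_mul hF (Complex.exp_bound hx hk) (norm_nonneg _) ((norm_nonneg _).trans hF)

section Basic

variable {ν : Measure Ω} [IsProbabilityMeasure ν] {C : Ω → ℝ} {F : Ω → ℂ} {M K : ℝ}

omit [MeasurableSpace Ω] in
/-- `‖e^{βC}‖ ≤ e^{‖β‖M}` when `|C| ≤ M`. [folklore] -/
theorem norm_exp_mul_le (hCb : ∀ ω, |C ω| ≤ M) (β : ℂ) (ω : Ω) :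
    ‖Complex.exp (β * (C ω : ℂ))‖ ≤ Real.exp (‖β‖ * M) := by
  rw [Complex.norm_exp]
  refine Real.exp_le_exp.2 ((Complex.re_le_norm _).trans ?_)
  rw [norm_mul, Complex.norm_real, Real.norm_eq_abs]
  exact mul_le_mul_of_nonneg_left (hCb ω) (norm_nonneg _)

/-- Measurability of the tilted integrand. [folklore] -/
theorem measurable_mul_exp (hCm : Measurable C) (hFm : Measurable F) (β : ℂ) :
    Measurable fun ω => F ω * Complex.exp (β * (C ω : ℂ)) :=
  hFm.mul (Complex.measurable_exp.comp ((Complex.measurable_ofReal.comp hCm).const_mul β))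

/-- Measurability of the moment integrand. [folklore] -/
theorem measurable_mul_pow (hCm : Measurable C) (hFm : Measurable F) (i : ℕ) :
    Measurable fun ω => F ω * (C ω : ℂ) ^ i :=
  hFm.mul ((Complex.measurable_ofReal.comp hCm).pow_const i)

/-- Integrability of the tilted integrand. [folklore] -/
theorem integrable_mul_exp (hCm : Measurable C) (hCb : ∀ ω, |C ω| ≤ M) (hFm : Measurable F)
    (hFb : ∀ ω, ‖F ω‖ ≤ K) (β : ℂ) :
    Integrable (fun ω => F ω * Complex.exp (β * (C ω : ℂ))) ν := by
  refine Integrable.of_bound (measurable_mul_exp hCm hFm β).aestronglyMeasurable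
    (K * Real.exp (‖β‖ * M)) (Eventually.of_forall fun ω => ?_)
  rw [norm_mul]
  exact mul_le_mul (hFb ω) (norm_exp_mul_le hCb β ω) (norm_nonneg _)
    ((norm_nonneg _).trans (hFb ω))

/-- Integrability of the moment integrand. [folklore] -/
theorem integrable_mul_pow (hCm : Measurable C) (hCb : ∀ ω, |C ω| ≤ M) (hFm : Measurable F)
    (hFb : ∀ ω, ‖F ω‖ ≤ K) (i : ℕ) :
    Integrable (fun ω => F ω * (C ω : ℂ) ^ i) ν := by
  refine Integrable.of_bound (measurable_mul_pow hCm hFm i).aestronglyMeasurable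
    (K * M ^ i) (Eventually.of_forall fun ω => ?_)
  rw [norm_mul, norm_pow, Complex.norm_real, Real.norm_eq_abs]
  exact mul_le_mul (hFb ω) (pow_le_pow_left₀ (abs_nonneg _) (hCb ω) i) (by positivity)
    ((norm_nonneg _).trans (hFb ω))

/-- The Taylor polynomial is the integral of the pointwise Taylor polynomial. [folklore] -/
theorem tiltPoly_eq_integral (hCm : Measurable C) (hCb : ∀ ω, |C ω| ≤ M) (hFm : Measurable F)
    (hFb : ∀ ω, ‖F ω‖ ≤ K) (k : ℕ) (β : ℂ) :
    tiltPoly ν C F k β =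
      ∫ ω, ∑ i ∈ range k, (β * (C ω : ℂ)) ^ i / (i.factorial : ℂ) * F ω ∂ν := by
  rw [integral_finsetSum _ fun i _ => ?_]
  · refine Finset.sum_congr rfl fun i _ => ?_
    rw [cmoment, ← integral_const_mul]
    refine integral_congr_ae (Eventually.of_forall fun ω => ?_)
    simp only [mul_pow]
    ring
  · have h := (integrable_mul_pow (ν := ν) hCm hCb hFm hFb i).const_mul (β ^ i / (i.factorial : ℂ))
    refine h.congr (Eventually.of_forall fun ω => ?_)
    simp only [mul_pow]
    ring

/-- **Taylor bound for the tilted integral**: `‖tilt β − tiltPoly k β‖ ≤ K (‖β‖M)ᵏ (k+1)/(k! k)` for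
`‖β‖ M ≤ 1`. [folklore] -/
theorem norm_tilt_sub_tiltPoly_le (hCm : Measurable C) (hCb : ∀ ω, |C ω| ≤ M) (hFm : Measurable F)
    (hFb : ∀ ω, ‖F ω‖ ≤ K) {k : ℕ} (hk : 0 < k) {β : ℂ} (hβ : ‖β‖ * M ≤ 1) :
    ‖tilt ν C F β - tiltPoly ν C F k β‖ ≤
      K * ((‖β‖ * M) ^ k * ((k.succ : ℝ) * ((k.factorial : ℝ) * k)⁻¹)) := by
  have hK : 0 ≤ K := (norm_nonneg _).trans (hFb (Classical.choice (by
    by_contra h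
    rw [not_nonempty_iff] at h
    have := IsProbabilityMeasure.measure_univ (μ := ν)
    rw [Set.univ_eq_empty_iff.2 h, measure_empty] at this
    exact zero_ne_one this)))
  rw [tilt, tiltPoly_eq_integral hCm hCb hFm hFb, ← integral_sub (integrable_mul_exp hCm hCb hFm hFb β)]
  · have hpt : ∀ ω, ‖F ω * Complex.exp (β * (C ω : ℂ)) -
        ∑ i ∈ range k, (β * (C ω : ℂ)) ^ i / (i.factorial : ℂ) * F ω‖ ≤
        K * ((‖β‖ * M) ^ k * ((k.succ : ℝ) * ((k.factorial : ℝ) * k)⁻¹)) := by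
      intro ω
      have hx : ‖β * (C ω : ℂ)‖ ≤ ‖β‖ * M := by
        rw [norm_mul, Complex.norm_real, Real.norm_eq_abs]
        exact mul_le_mul_of_nonneg_left (hCb ω) (norm_nonneg _)
      refine (norm_mul_exp_sub_sum_le (hFb ω) (hx.trans hβ) hk).trans ?_
      refine mul_le_mul_of_nonneg_left (mul_le_mul_of_nonneg_right
        (pow_le_pow_left₀ (norm_nonneg _) hx k) (by positivity)) hK
    calc ‖∫ ω, (F ω * Complex.exp (β * (C ω : ℂ)) -
            ∑ i ∈ range k, (β * (C ω : ℂ)) ^ i / (i.factorial : ℂ) * F ω) ∂ν‖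
        ≤ K * ((‖β‖ * M) ^ k * ((k.succ : ℝ) * ((k.factorial : ℝ) * k)⁻¹)) * (ν Set.univ).toReal :=
          norm_integral_le_of_norm_le_const (Eventually.of_forall hpt)
      _ = _ := by rw [measure_univ, ENNReal.toReal_one, mul_one]
  · refine integrable_finsetSum _ fun i _ => ?_
    have h := (integrable_mul_pow (ν := ν) hCm hCb hFm hFb i).const_mul (β ^ i / (i.factorial : ℂ))
    refine h.congr (Eventually.of_forall fun ω => ?_)
    simp only [mul_pow]
    ring

/-- **The Taylor jet of a tilted integral**: `tilt β = ∑_{i<k} βⁱ/i! ∫F Cⁱ + O(βᵏ)` at `β = 0`. [folklore] -/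
theorem tilt_jetEq (hCm : Measurable C) (hCb : ∀ ω, |C ω| ≤ M) (hM : 0 ≤ M) (hFm : Measurable F)
    (hFb : ∀ ω, ‖F ω‖ ≤ K) {k : ℕ} (hk : 0 < k) :
    JetEq k (tilt ν C F) (tiltPoly ν C F k) := by
  refine Asymptotics.IsBigO.of_bound (K * (M ^ k * ((k.succ : ℝ) * ((k.factorial : ℝ) * k)⁻¹))) ?_
  have hr : 0 < 1 / (M + 1) := by positivity
  filter_upwards [Metric.ball_mem_nhds (0 : ℂ) hr] with β hβ
  rw [Metric.mem_ball, dist_zero_right] at hβ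
  have hβM : ‖β‖ * M ≤ 1 := by
    have h1 : ‖β‖ * M ≤ 1 / (M + 1) * M :=
      mul_le_mul_of_nonneg_right hβ.le hM
    refine h1.trans ?_
    rw [div_mul_eq_mul_div, one_mul, div_le_one (by positivity)]
    linarith
  refine (norm_tilt_sub_tiltPoly_le hCm hCb hFm hFb hk hβM).trans (le_of_eq ?_)
  rw [norm_pow, mul_pow]
  ring

/-- The tilted integral is bounded near `β = 0`. [folklore] -/
theorem bddAt_tilt (hCb : ∀ ω, |C ω| ≤ M) (hM : 0 ≤ M) (hFb : ∀ ω, ‖F ω‖ ≤ K) :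
    BddAt (tilt ν C F) := by
  refine BddAt.of_norm_le (C := K * Real.exp M) ?_
  filter_upwards [Metric.ball_mem_nhds (0 : ℂ) one_pos] with β hβ
  rw [Metric.mem_ball, dist_zero_right] at hβ
  have hpt : ∀ ω, ‖F ω * Complex.exp (β * (C ω : ℂ))‖ ≤ K * Real.exp M := by
    intro ω
    rw [norm_mul]
    refine mul_le_mul (hFb ω) ((norm_exp_mul_le hCb β ω).trans (Real.exp_le_exp.2 ?_))
      (norm_nonneg _) ((norm_nonneg _).trans (hFb ω))
    calc ‖β‖ * M ≤ 1 * M := mul_le_mul_of_nonneg_right hβ.le hM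
      _ = M := one_mul M
  calc ‖tilt ν C F β‖ ≤ K * Real.exp M * (ν Set.univ).toReal :=
        norm_integral_le_of_norm_le_const (Eventually.of_forall hpt)
    _ = K * Real.exp M := by rw [measure_univ, ENNReal.toReal_one, mul_one]

/-- A continuous function of the coupling is bounded near `β = 0`. [folklore] -/
theorem bddAt_of_continuous {f : ℂ → ℂ} (hf : Continuous f) : BddAt f := by
  obtain ⟨B, hB⟩ := (isCompact_closedBall (0 : ℂ) 1).exists_bound_of_continuousOn hf.continuousOn
  refine BddAt.of_norm_le (C := B) ?_
  filter_upwards [Metric.closedBall_mem_nhds (0 : ℂ) one_pos] with β hβ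
  exact hB β hβ

omit [IsProbabilityMeasure ν] in
/-- The Taylor polynomials are continuous. [folklore] -/
theorem continuous_tiltPoly (k : ℕ) : Continuous (tiltPoly ν C F k) := by
  unfold tiltPoly
  exact continuous_finsetSum _ fun i _ => ((continuous_pow i).div_const _).mul continuous_const

omit [IsProbabilityMeasure ν] in
/-- The Taylor polynomial at `β = 0` is the zeroth moment (for `k ≥ 1`). [folklore] -/
theorem tiltPoly_zero {k : ℕ} (hk : 0 < k) : tiltPoly ν C F k 0 = cmoment ν C F 0 := by
  unfold tiltPoly
  rw [Finset.sum_eq_single 0]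
  · simp
  · intro i _ hi
    simp [zero_pow hi]
  · intro h
    exact absurd (Finset.mem_range.2 hk) h

omit [IsProbabilityMeasure ν] in
/-- Real moments: `∫ (f : ℂ) Cⁱ = ((∫ f Cⁱ : ℝ) : ℂ)`. [folklore] -/
theorem cmoment_ofReal (f : Ω → ℝ) (i : ℕ) :
    cmoment ν C (fun ω => (f ω : ℂ)) i = ((∫ ω, f ω * C ω ^ i ∂ν : ℝ) : ℂ) := by
  rw [cmoment, ← integral_complex_ofReal]
  refine integral_congr_ae (Eventually.of_forall fun ω => ?_)
  push_cast
  ring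

/-- The zeroth moment of the constant `1` is `1`. [folklore] -/
theorem cmoment_one_zero : cmoment ν C (fun _ => (1 : ℂ)) 0 = 1 := by
  simp [cmoment]

omit [IsProbabilityMeasure ν] in
/-- Moments of the constant `1`: `∫ 1 · Cⁱ = ((∫ Cⁱ : ℝ) : ℂ)`. [folklore] -/
theorem cmoment_one (i : ℕ) :
    cmoment ν C (fun _ => (1 : ℂ)) i = ((∫ ω, C ω ^ i ∂ν : ℝ) : ℂ) := by
  rw [cmoment, ← integral_complex_ofReal]
  refine integral_congr_ae (Eventually.of_forall fun ω => ?_)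
  push_cast
  ring

/-- **The normalising integral tends to `1`** as `β → 0`. [folklore] -/
theorem tendsto_tilt_one (hCm : Measurable C) (hCb : ∀ ω, |C ω| ≤ M) (hM : 0 ≤ M) :
    Tendsto (tilt ν C fun _ => (1 : ℂ)) (𝓝 0) (𝓝 1) := by
  have hj := tilt_jetEq (ν := ν) (F := fun _ => (1 : ℂ)) (K := 1) hCm hCb hM measurable_const
    (fun _ => by simp) one_pos
  have hpoly : tiltPoly ν C (fun _ => (1 : ℂ)) 1 = fun _ => 1 := by
    funext β
    simp [tiltPoly, cmoment_one_zero]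
  rw [JetEq, hpoly] at hj
  have h0 : Tendsto (fun β : ℂ => tilt ν C (fun _ => (1 : ℂ)) β - 1) (𝓝 0) (𝓝 0) := by
    refine hj.trans_tendsto ?_
    have : Tendsto (fun β : ℂ => β ^ 1) (𝓝 0) (𝓝 (0 ^ 1)) := (continuous_pow 1).tendsto 0
    simpa using this
  have := h0.add_const 1
  simpa using this

/-- Near `β = 0` the normalising integral has modulus at least `1/2`. [folklore] -/
theorem eventually_half_le_norm_tilt_one (hCm : Measurable C) (hCb : ∀ ω, |C ω| ≤ M) (hM : 0 ≤ M) :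
    ∀ᶠ β in 𝓝 (0 : ℂ), 1 / 2 ≤ ‖tilt ν C (fun _ => (1 : ℂ)) β‖ := by
  have h := (tendsto_tilt_one (ν := ν) hCm hCb hM).eventually
    (Metric.ball_mem_nhds (1 : ℂ) (by norm_num : (0 : ℝ) < 1 / 2))
  filter_upwards [h] with β hβ
  replace hβ : ‖tilt ν C (fun _ => (1 : ℂ)) β - 1‖ < 1 / 2 := by rwa [← dist_eq_norm]
  have : ‖(1 : ℂ)‖ ≤ ‖tilt ν C (fun _ => (1 : ℂ)) β‖ + ‖tilt ν C (fun _ => (1 : ℂ)) β - 1‖ := by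
    calc ‖(1 : ℂ)‖ = ‖tilt ν C (fun _ => (1 : ℂ)) β - (tilt ν C (fun _ => (1 : ℂ)) β - 1)‖ := by
          congr 1; ring
      _ ≤ _ := norm_sub_le _ _
  rw [norm_one] at this
  linarith

/-- Near `β = 0` the normalising integral does not vanish. [folklore] -/
theorem eventually_tilt_one_ne_zero (hCm : Measurable C) (hCb : ∀ ω, |C ω| ≤ M) (hM : 0 ≤ M) :
    ∀ᶠ β in 𝓝 (0 : ℂ), tilt ν C (fun _ => (1 : ℂ)) β ≠ 0 := by
  filter_upwards [eventually_half_le_norm_tilt_one (ν := ν) hCm hCb hM] with β hβ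
  intro h
  rw [h, norm_zero] at hβ
  norm_num at hβ

/-- The inverse of the normalising integral is bounded near `β = 0`. [folklore] -/
theorem bddAt_inv_tilt_one (hCm : Measurable C) (hCb : ∀ ω, |C ω| ≤ M) (hM : 0 ≤ M) :
    BddAt fun β => (tilt ν C (fun _ => (1 : ℂ)) β)⁻¹ := by
  refine BddAt.of_norm_le (C := 2) ?_
  filter_upwards [eventually_half_le_norm_tilt_one (ν := ν) hCm hCb hM] with β hβ
  rw [norm_inv]
  have hpos : 0 < ‖tilt ν C (fun _ => (1 : ℂ)) β‖ := by linarith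
  rw [inv_le_comm₀ hpos (by norm_num : (0 : ℝ) < 2)]
  linarith

/-- A continuous function of the coupling with value `1` at `0` is eventually non-zero with
bounded inverse. [folklore] -/
theorem eventually_ne_zero_and_bddAt_inv_of_continuous {f : ℂ → ℂ} (hf : Continuous f)
    (h0 : f 0 = 1) : (∀ᶠ β in 𝓝 (0 : ℂ), f β ≠ 0) ∧ BddAt fun β => (f β)⁻¹ := by
  have ht : Tendsto f (𝓝 0) (𝓝 1) := by simpa [h0] using hf.tendsto 0
  have h := ht.eventually (Metric.ball_mem_nhds (1 : ℂ) (by norm_num : (0 : ℝ) < 1 / 2))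
  have hhalf : ∀ᶠ β in 𝓝 (0 : ℂ), 1 / 2 ≤ ‖f β‖ := by
    filter_upwards [h] with β hβ
    replace hβ : ‖f β - 1‖ < 1 / 2 := by rwa [← dist_eq_norm]
    have : ‖(1 : ℂ)‖ ≤ ‖f β‖ + ‖f β - 1‖ := by
      calc ‖(1 : ℂ)‖ = ‖f β - (f β - 1)‖ := by congr 1; ring
        _ ≤ _ := norm_sub_le _ _
    rw [norm_one] at this
    linarith
  refine ⟨?_, BddAt.of_norm_le (C := 2) ?_⟩
  · filter_upwards [hhalf] with β hβ
    intro h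
    rw [h, norm_zero] at hβ
    norm_num at hβ
  · filter_upwards [hhalf] with β hβ
    rw [norm_inv]
    have hpos : 0 < ‖f β‖ := by linarith
    rw [inv_le_comm₀ hpos (by norm_num : (0 : ℝ) < 2)]
    linarith

end Basic

end Summit.Ventures.LatticeQCDFlow.Theory2.Tilted

end
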